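import Summits.Ventures.Crystal3D.Bulk.HalfTanSoundZ
import HarnessLib

/-!
# Soundness of the integer form of the Tammes-bridge certificate, II: tables, affine enclosures, bisection

Venture `Crystal3D` (cell `pub-crystal3d`, phase 2; seat p3; box rule by seat idea-2, `phase2/idea2/TAMMES-BRIDGE.md` §F).
Continuation of `HalfTanSoundZ.lean` (which proves `CertZ.dec2_sound`, the three integer tests ⇒ `T(W₁, W₂, c) ≤ 0`):

* (z1) the integer node tables of `HalfTanCertZ.lean` are exactly `2³⁶ ·` the rational ones of `HalfTanCert.lean`
  (`tables_agree`, kernel `decide`); integer widths positive, rises nonnegative (`nd_mono`); `slope k = rise / width` (`slope_real`);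
* (z2) the floor / ceiling enclosures `Wlo ≤ 2³⁶ · Waff k w ≤ Whi` on an integer box of piece `k` (`Wlo_le`, `le_Whi`);
* (z4) `certBoxZ_sound` (induction on the bisection fuel; an integer midpoint splits the real box) and **`certPairZ_sound`** —
  the conclusion of `CertW.certPair_sound`, from `CertZ.certPairZ ka kb = true`.

HONEST FRAMING: elementary real algebra and cast bookkeeping; standard axioms; nothing geometric. With `CertZ.certPairZ_true`
(`HalfTanCertZAll.lean`) it discharges `CertW.tpoly_nonpos_of_pieces` without `native_decide`.
-/

namespace Summit.Ventures.Crystal3D.TammesBridge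

namespace CertZ

/-! ### The node tables and the affine enclosures -/

/-- The integer node tables are `2³⁶` times the rational ones of `HalfTanCert` (kernel evaluation). [folklore] -/
theorem tables_agree : ∀ k < 254, (nd nodesWZ k : ℚ) = CertW.nodesW[k]! * 68719476736 ∧
    (nd nodesVZ k : ℚ) = CertW.nodesV[k]! * 68719476736 := by
  decide +kernel

/-- Real form of the abscissa table link. [folklore] -/
theorem ndW_real (k : ℕ) (hk : k < 254) : ((nd nodesWZ k : ℕ) : ℝ) = 68719476736 * ((CertW.nodesW[k]! : ℚ) : ℝ) := by
  have h := (tables_agree k hk).1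
  have h' : (((nd nodesWZ k : ℕ) : ℚ) : ℝ) = (((CertW.nodesW[k]! * 68719476736 : ℚ)) : ℝ) := by rw [h]
  push_cast at h'
  linarith only [h']

/-- Real form of the ordinate table link. [folklore] -/
theorem ndV_real (k : ℕ) (hk : k < 254) : ((nd nodesVZ k : ℕ) : ℝ) = 68719476736 * ((CertW.nodesV[k]! : ℚ) : ℝ) := by
  have h := (tables_agree k hk).2
  have h' : (((nd nodesVZ k : ℕ) : ℚ) : ℝ) = (((CertW.nodesV[k]! * 68719476736 : ℚ)) : ℝ) := by rw [h]
  push_cast at h'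
  linarith only [h']

/-- Abscissa nodes increase, ordinate nodes do not decrease (integer tables). [folklore] -/
theorem nd_mono (k : ℕ) (hk : k < 253) : nd nodesWZ k < nd nodesWZ (k + 1) ∧ nd nodesVZ k ≤ nd nodesVZ (k + 1) := by
  have hm := CertW.nodes_mono k hk
  have h1 : ((nd nodesWZ k : ℕ) : ℝ) < ((nd nodesWZ (k + 1) : ℕ) : ℝ) := by
    rw [ndW_real k (by omega), ndW_real (k + 1) (by omega)]
    have : ((CertW.nodesW[k]! : ℚ) : ℝ) < ((CertW.nodesW[k+1]! : ℚ) : ℝ) := by exact_mod_cast hm.1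
    linarith only [this]
  have h2 : ((nd nodesVZ k : ℕ) : ℝ) ≤ ((nd nodesVZ (k + 1) : ℕ) : ℝ) := by
    rw [ndV_real k (by omega), ndV_real (k + 1) (by omega)]
    have : ((CertW.nodesV[k]! : ℚ) : ℝ) ≤ ((CertW.nodesV[k+1]! : ℚ) : ℝ) := by exact_mod_cast hm.2
    linarith only [this]
  exact ⟨by exact_mod_cast h1, by exact_mod_cast h2⟩

/-- The slope of piece `k` is the ratio of the integer rise and width. [folklore] -/
theorem slope_real (k : ℕ) (hk : k < 253) :
    ((CertW.slope k : ℚ) : ℝ) = ((nd nodesVZ (k + 1) - nd nodesVZ k : ℕ) : ℝ) / ((nd nodesWZ (k + 1) - nd nodesWZ k : ℕ) : ℝ) ∧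
    0 ≤ ((CertW.slope k : ℚ) : ℝ) ∧ (0 : ℝ) < ((nd nodesWZ (k + 1) - nd nodesWZ k : ℕ) : ℝ) := by
  obtain ⟨hw, hv⟩ := nd_mono k hk
  have hW := CertW.nodes_mono k hk
  rw [Nat.cast_sub hw.le, Nat.cast_sub hv, ndW_real k (by omega), ndW_real (k+1) (by omega), ndV_real k (by omega),
    ndV_real (k+1) (by omega)]
  have hden : (0 : ℝ) < ((CertW.nodesW[k+1]! : ℚ) : ℝ) - ((CertW.nodesW[k]! : ℚ) : ℝ) := by
    have : ((CertW.nodesW[k]! : ℚ) : ℝ) < ((CertW.nodesW[k+1]! : ℚ) : ℝ) := by exact_mod_cast hW.1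
    linarith only [this]
  have hnum : (0 : ℝ) ≤ ((CertW.nodesV[k+1]! : ℚ) : ℝ) - ((CertW.nodesV[k]! : ℚ) : ℝ) := by
    have : ((CertW.nodesV[k]! : ℚ) : ℝ) ≤ ((CertW.nodesV[k+1]! : ℚ) : ℝ) := by exact_mod_cast hW.2
    linarith only [this]
  have hs : ((CertW.slope k : ℚ) : ℝ) =
      (((CertW.nodesV[k+1]! : ℚ) : ℝ) - ((CertW.nodesV[k]! : ℚ) : ℝ)) / (((CertW.nodesW[k+1]! : ℚ) : ℝ) - ((CertW.nodesW[k]! : ℚ) : ℝ)) := by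
    unfold CertW.slope; push_cast; rfl
  refine ⟨?_, ?_, by linarith only [hden]⟩
  · rw [hs, ← mul_sub, ← mul_sub, mul_div_mul_left _ _ (by norm_num : (68719476736 : ℝ) ≠ 0)]
  · rw [hs]; exact div_nonneg hnum hden.le

/-- Ceiling division bounds from above: `n ≤ ⌈n / d⌉ · d` in the form the checker uses. [folklore] -/
theorem le_ceil_mul (n d : ℕ) (hd : 0 < d) : n ≤ (n + (d - 1)) / d * d := by
  have h1 := Nat.div_add_mod (n + (d - 1)) d
  have h2 := Nat.mod_lt (n + (d - 1)) hd
  rw [Nat.mul_comm] at h1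
  generalize (n + (d - 1)) / d * d = Q at h1 ⊢
  generalize (n + (d - 1)) % d = m at h1 h2
  omega

/-- **Lower enclosure:** on piece `k`, for a scaled abscissa `x ≥ 2³⁶ w_k` below `2³⁶ w`, `Wlo ≤ 2³⁶ · Waff k w`. [folklore] -/
theorem Wlo_le (k : ℕ) (hk : k < 253) {x : ℕ} (hx : nd nodesWZ k ≤ x) {w : ℝ} (hw : (x : ℝ) ≤ 68719476736 * w) :
    ((Wlo (nd nodesVZ k) (nd nodesVZ (k + 1) - nd nodesVZ k) (nd nodesWZ k) (nd nodesWZ (k + 1) - nd nodesWZ k) x : ℕ) : ℝ) ≤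
      68719476736 * CertW.WaffR k w := by
  obtain ⟨hs, hs0, hdw⟩ := slope_real k hk
  rw [Wlo_eq]
  push_cast
  have hdiv := Nat.cast_div_le (α := ℝ) (m := (nd nodesVZ (k + 1) - nd nodesVZ k) * (x - nd nodesWZ k))
    (n := nd nodesWZ (k + 1) - nd nodesWZ k)
  have hx' : ((x - nd nodesWZ k : ℕ) : ℝ) = (x : ℝ) - (nd nodesWZ k : ℕ) := by push_cast [Nat.cast_sub hx]; ring
  have hstep : (((nd nodesVZ (k + 1) - nd nodesVZ k) * (x - nd nodesWZ k) : ℕ) : ℝ) / ((nd nodesWZ (k + 1) - nd nodesWZ k : ℕ) : ℝ)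
      = ((CertW.slope k : ℚ) : ℝ) * ((x : ℝ) - (nd nodesWZ k : ℕ)) := by
    rw [hs, Nat.cast_mul, hx', div_mul_eq_mul_div, mul_comm]
  have hmono : ((CertW.slope k : ℚ) : ℝ) * ((x : ℝ) - (nd nodesWZ k : ℕ)) ≤
      ((CertW.slope k : ℚ) : ℝ) * (68719476736 * w - (nd nodesWZ k : ℕ)) :=
    mul_le_mul_of_nonneg_left (by linarith only [hw]) hs0
  have hW : 68719476736 * CertW.WaffR k w =
      ((nd nodesVZ k : ℕ) : ℝ) + ((CertW.slope k : ℚ) : ℝ) * (68719476736 * w - (nd nodesWZ k : ℕ)) := by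
    unfold CertW.WaffR; rw [ndV_real k (by omega), ndW_real k (by omega)]; ring
  rw [hW]
  linarith only [hdiv, hstep, hmono]

/-- **Upper enclosure:** on piece `k`, for a scaled abscissa `x ≥ 2³⁶ w_k` above `2³⁶ w`, `2³⁶ · Waff k w ≤ Whi`. [folklore] -/
theorem le_Whi (k : ℕ) (hk : k < 253) {x : ℕ} (hx : nd nodesWZ k ≤ x) {w : ℝ} (hw : 68719476736 * w ≤ (x : ℝ)) :
    68719476736 * CertW.WaffR k w ≤
      ((Whi (nd nodesVZ k) (nd nodesVZ (k + 1) - nd nodesVZ k) (nd nodesWZ k) (nd nodesWZ (k + 1) - nd nodesWZ k) x : ℕ) : ℝ) := by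
  obtain ⟨hs, hs0, hdw⟩ := slope_real k hk
  rw [Whi_eq]
  push_cast
  set n : ℕ := (nd nodesVZ (k + 1) - nd nodesVZ k) * (x - nd nodesWZ k) with hn
  set d : ℕ := nd nodesWZ (k + 1) - nd nodesWZ k with hd
  have hdpos : 0 < d := by exact_mod_cast hdw
  have hceil : (n : ℝ) ≤ (((n + (d - 1)) / d : ℕ) : ℝ) * (d : ℝ) := by exact_mod_cast le_ceil_mul n d hdpos
  have hceil' : (n : ℝ) / d ≤ (((n + (d - 1)) / d : ℕ) : ℝ) := (div_le_iff₀ hdw).2 hceil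
  have hx' : ((x - nd nodesWZ k : ℕ) : ℝ) = (x : ℝ) - (nd nodesWZ k : ℕ) := by push_cast [Nat.cast_sub hx]; ring
  have hstep : (n : ℝ) / d = ((CertW.slope k : ℚ) : ℝ) * ((x : ℝ) - (nd nodesWZ k : ℕ)) := by
    rw [hn, hs, Nat.cast_mul, hx', hd, div_mul_eq_mul_div, mul_comm]
  have hmono : ((CertW.slope k : ℚ) : ℝ) * (68719476736 * w - (nd nodesWZ k : ℕ)) ≤
      ((CertW.slope k : ℚ) : ℝ) * ((x : ℝ) - (nd nodesWZ k : ℕ)) :=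
    mul_le_mul_of_nonneg_left (by linarith only [hw]) hs0
  have hW : 68719476736 * CertW.WaffR k w =
      ((nd nodesVZ k : ℕ) : ℝ) + ((CertW.slope k : ℚ) : ℝ) * (68719476736 * w - (nd nodesWZ k : ℕ)) := by
    unfold CertW.WaffR; rw [ndV_real k (by omega), ndW_real k (by omega)]; ring
  rw [hW]
  linarith only [hceil', hstep, hmono]

/-! ### The recursive certificate -/

/-- **Soundness of the integer bisection** for the piece pair `(ka, kb)`: a certified box `[p, q] × [r, s]` (scaled, inside the
pieces) satisfies the target inequality at every real point, for the affine profile values. [folklore] -/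
theorem certBoxZ_sound {ka kb : ℕ} (hka : ka < 253) (hkb : kb < 253) :
    ∀ (fuel p q r s : ℕ), certBoxZ (nd nodesWZ ka) (nd nodesWZ (ka + 1) - nd nodesWZ ka) (nd nodesVZ ka)
        (nd nodesVZ (ka + 1) - nd nodesVZ ka) (nd nodesWZ kb) (nd nodesWZ (kb + 1) - nd nodesWZ kb) (nd nodesVZ kb)
        (nd nodesVZ (kb + 1) - nd nodesVZ kb) fuel p q r s = true →
      nd nodesWZ ka ≤ p → p ≤ q → nd nodesWZ kb ≤ r → r ≤ s →
      ∀ {w₁ w₂ c : ℝ}, (p : ℝ) ≤ 68719476736 * w₁ → 68719476736 * w₁ ≤ q → (r : ℝ) ≤ 68719476736 * w₂ →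
        68719476736 * w₂ ≤ s → -1 ≤ c → c ≤ 1 → 4 * w₁ * w₂ * c ≤ CertW.Epoly w₁ w₂ →
        CertW.Tpoly (CertW.WaffR ka w₁) (CertW.WaffR kb w₂) c ≤ 0 := by
  intro fuel
  induction fuel with
  | zero => intro p q r s h; simp [certBoxZ] at h
  | succ n ih =>
    intro p q r s h hap hpq hbr hrs w₁ w₂ c hp hq hr hs hc1 hc2 hcon
    unfold certBoxZ at h
    cases hdec : decideBoxZ (nd nodesWZ ka) (nd nodesWZ (ka + 1) - nd nodesWZ ka) (nd nodesVZ ka)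
        (nd nodesVZ (ka + 1) - nd nodesVZ ka) (nd nodesWZ kb) (nd nodesWZ (kb + 1) - nd nodesWZ kb) (nd nodesVZ kb)
        (nd nodesVZ (kb + 1) - nd nodesVZ kb) p q r s with
    | true =>
      -- the box is decided: stages 2–5 with the affine enclosures
      exact dec2_sound hdec hp hq hr hs (Wlo_le ka hka hap hp) (le_Whi ka hka (hap.trans hpq) hq)
        (Wlo_le kb hkb hbr hr) (le_Whi kb hkb (hbr.trans hrs) hs) hc1 hc2 hcon
    | false =>
      rw [hdec, Bool.false_or] at h
      cases hlong : Nat.ble (Nat.sub s r) (Nat.sub q p) with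
      | true =>
        -- bisect [p, q] at m = (p + q) / 2
        rw [hlong, cond_true, Bool.and_eq_true] at h
        have hm : p ≤ (p + q) / 2 ∧ (p + q) / 2 ≤ q := by omega
        rcases le_total (68719476736 * w₁) ((((p + q) / 2 : ℕ)) : ℝ) with hle | hle
        · exact ih p ((p + q) / 2) r s h.1 hap hm.1 hbr hrs hp hle hr hs hc1 hc2 hcon
        · exact ih ((p + q) / 2) q r s h.2 (hap.trans hm.1) hm.2 hbr hrs hle hq hr hs hc1 hc2 hcon
      | false =>
        -- bisect [r, s] at m = (r + s) / 2
        rw [hlong, cond_false, Bool.and_eq_true] at h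
        have hm : r ≤ (r + s) / 2 ∧ (r + s) / 2 ≤ s := by omega
        rcases le_total (68719476736 * w₂) ((((r + s) / 2 : ℕ)) : ℝ) with hle | hle
        · exact ih p q r ((r + s) / 2) h.1 hap hpq hbr hm.1 hp hq hr hle hc1 hc2 hcon
        · exact ih p q ((r + s) / 2) s h.2 hap hpq (hbr.trans hm.1) hm.2 hp hq hle hs hc1 hc2 hcon

/-- **Soundness of the integer certificate of a piece pair**, in the shape of `CertW.certPair_sound`: on
`[w_ka, w_ka+1] × [w_kb, w_kb+1]` the target inequality holds for the affine profile values. [folklore] -/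
theorem certPairZ_sound {ka kb : ℕ} (hka : ka < 253) (hkb : kb < 253) (h : certPairZ ka kb = true) {w₁ w₂ c : ℝ}
    (hw₁ : CertW.I.mem ⟨CertW.nodesW[ka]!, CertW.nodesW[ka+1]!⟩ w₁)
    (hw₂ : CertW.I.mem ⟨CertW.nodesW[kb]!, CertW.nodesW[kb+1]!⟩ w₂) (hc1 : -1 ≤ c) (hc2 : c ≤ 1)
    (hcon : 4 * w₁ * w₂ * c ≤ CertW.Epoly w₁ w₂) : CertW.Tpoly (CertW.WaffR ka w₁) (CertW.WaffR kb w₂) c ≤ 0 := by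
  obtain ⟨h1l, h1h⟩ := hw₁
  obtain ⟨h2l, h2h⟩ := hw₂
  have ea := ndW_real ka (by omega)
  have ea1 := ndW_real (ka + 1) (by omega)
  have eb := ndW_real kb (by omega)
  have eb1 := ndW_real (kb + 1) (by omega)
  exact certBoxZ_sound hka hkb 18 _ _ _ _ h le_rfl (nd_mono ka hka).1.le le_rfl (nd_mono kb hkb).1.le
    (by rw [ea]; linarith only [h1l]) (by rw [ea1]; linarith only [h1h]) (by rw [eb]; linarith only [h2l])
    (by rw [eb1]; linarith only [h2h]) hc1 hc2 hcon

end CertZ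

end Summit.Ventures.Crystal3D.TammesBridge
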